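import Literature.Geometry.Kaehler.ComplexTorusLieGroup
import Mathlib.Geometry.Manifold.Algebra.LieGroup
import HarnessLib

/-!
# A complex torus is a complex Lie group: the `LieAddGroup` instances

Companion of `Literature/Geometry/Kaehler/ComplexTorusLieGroup.lean` (which proves that the
group law `X × X → X` and negation of a complex torus `X = E/Φ(ℤ^ι)` are `C^n` over
`𝕜 ∈ {ℝ, ℂ}`: `ComplexTorus.contMDiff_add`, `ComplexTorus.contMDiff_neg`). This file only
REGISTERS the two resulting Mathlib instances

* `ComplexTorus.instLieAddGroupComplex : LieAddGroup 𝓘(ℂ, E) ω (ComplexTorus Φ)` — **a complex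
  torus is a complex Lie group** (Lange–Birkenhake (1992), Ch. 1 §1.1: "a complex torus … is a
  connected compact complex Lie group"; Mumford, *Abelian Varieties*, §1 (1));
* `ComplexTorus.instLieAddGroupReal : LieAddGroup 𝓘(ℝ, E) ∞ (ComplexTorus Φ)` — its underlying
  real Lie group (matching `ComplexTorus.instIsManifoldReal`),

so that Mathlib's `ContMDiff.add`, `ContMDiff.neg`, `ContMDiff.sub`, `ContMDiff.sum`, … apply to
torus-valued maps. No new mathematics; kept in a separate (reviewed) file so that the theorem
file stays definition-free.

## References

* H. Lange, Ch. Birkenhake, *Complex Abelian Varieties*, Grundlehren 302 (1992), Ch. 1 §1.1.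
  [LangeBirkenhake1992]
* D. Mumford, *Abelian Varieties* (1970), §1 (1). [MumfordAV1970]
-/

noncomputable section

open scoped Manifold ContDiff

namespace Literature.Geometry.Kaehler

namespace ComplexTorus

variable {ι : Type*} {E : Type*} [NormedAddCommGroup E] [NormedSpace ℂ E]
  {Φ : (ι → ℝ) ≃L[ℝ] E} [Fintype ι]

/-- **A complex torus is a complex Lie group**: addition and negation of `X = E/Φ(ℤ^ι)` are
holomorphic (`LieAddGroup` for the model `𝓘(ℂ, E)` and smoothness `ω`;
`ComplexTorus.contMDiff_add`, `ComplexTorus.contMDiff_neg`). Lange–Birkenhake (1992), Ch. 1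
§1.1; Mumford, *Abelian Varieties*, §1 (1). [cite: LangeBirkenhake1992, §1.1.1] -/
instance instLieAddGroupComplex : LieAddGroup 𝓘(ℂ, E) ω (ComplexTorus Φ) where
  contMDiff_add := contMDiff_add
  contMDiff_neg := contMDiff_neg

/-- The underlying real Lie group of a complex torus (`LieAddGroup` for the model `𝓘(ℝ, E)` and
smoothness `∞`, matching `ComplexTorus.instIsManifoldReal`). [cite: LangeBirkenhake1992, §1.1.1] -/
instance instLieAddGroupReal : LieAddGroup 𝓘(ℝ, E) ∞ (ComplexTorus Φ) where
  contMDiff_add := contMDiff_add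
  contMDiff_neg := contMDiff_neg

/-- Sanity check of the instances: a sum of two holomorphic torus-valued maps on a complex
manifold is holomorphic (Mathlib `ContMDiff.add`, available through `instLieAddGroupComplex`).
[cite: LangeBirkenhake1992, §1.1.1] -/
theorem contMDiff_add_of_contMDiff {F : Type*} [NormedAddCommGroup F] [NormedSpace ℂ F]
    {H : Type*} [TopologicalSpace H] {I : ModelWithCorners ℂ F H} {M : Type*}
    [TopologicalSpace M] [ChartedSpace H M] {f g : M → ComplexTorus Φ}
    (hf : ContMDiff I 𝓘(ℂ, E) ω f) (hg : ContMDiff I 𝓘(ℂ, E) ω g) :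
    ContMDiff I 𝓘(ℂ, E) ω (fun x ↦ f x + g x) :=
  hf.add hg

end ComplexTorus

end Literature.Geometry.Kaehler
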